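import Literature.AlgebraicGeometry.HodgeTheory.AbelianVarietyHodgeEssentialImageHolds
import Literature.AlgebraicGeometry.Motives.WeightOneHodgeStructureOfPeriod
import Literature.AlgebraicGeometry.HodgeTheory.NonCMEllipticCurvePowersHodgeClasses
import Literature.AlgebraicGeometry.HodgeTheory.EllipticCurvesProductsHodgeClassesOfRiemann
import Literature.AlgebraicGeometry.HodgeTheory.BettiOneHodgeStructureModelIndependence
import Literature.AlgebraicGeometry.HodgeTheory.BettiUniverseCMAction
import Literature.AlgebraicGeometry.HodgeTheory.ComplexConjugationHolds
import Literature.AlgebraicGeometry.HodgeTheory.HodgeFiltrationModelsReductionProofs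
import Literature.AlgebraicGeometry.ComplexMultiplication.EndAlgebraCommSubalgebraDegreeBound
import Literature.AlgebraicGeometry.ComplexMultiplication.CenterEndAlgebraTotallyRealOrCMOfRiemann
import Literature.AlgebraicGeometry.Milne1999.HodgeCMImpliesTateFiniteFields
import Literature.NumberTheory.DiophantineGeometry.AVIsogenyTateHoldsProofs
import Mathlib.NumberTheory.Real.Irrational
import HarnessLib

/-!
# A complex elliptic curve without complex multiplication exists

NON-VACUITY, as a kernel object, of the hypothesis class «elliptic curve without complex multiplication» of the
tree — `HodgeTheory.EllipticCurve.HodgeEndTrivial E` (every `ℂ`-linear endomorphism of `H¹(E(ℂ); ℂ)` preserving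
rational classes and the Hodge types `(1,0)`, `(0,1)` is a scalar: Moonen–Zarhin 1999 §2, `g = 1`, Type I(1)), the
hypothesis of `HodgeTheory/NonCMEllipticCurvePowersHodgeClasses`, `…/NonCMEllipticCurvesProductsHodgeClasses`,
`…/CMTimesNonCMEllipticProductsHodgeClasses`, `…/MixedEllipticCurvesProductsHodgeClasses` — and of «not of CM
type» (`¬ Milne1999.IsOfCMType`, the complement of the hypothesis class of HC_CM):

* `exists_ellipticCurve_not_isOfCMType` — **there is a complex abelian variety `E` of dimension `1` with
  `EllipticCurve.HodgeEndTrivial E`, `dim_ℚ End⁰(E) = 1` (`End⁰(E) = ℚ`) and `¬ Milne1999.IsOfCMType E`**;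
  its corollaries `exists_ellipticCurve_hodgeEndTrivial`, `exists_abelianVariety_not_isOfCMType`,
  `exists_abelianVariety_finrank_endAlgebra_eq_one`.

PROOF.  `Geometry/WeightOneHodgeStructureOfPeriod` supplies a polarisable effective weight-one `ℚ`-Hodge structure
`H` on `ℚ²` whose endomorphisms are the rational scalars (`V¹_{τ₀}`, `τ₀ = √2 + i`).  By RIEMANN'S THEOREM —
Deligne–Milne 1982, *Tannakian Categories*, Thm. 6.20, essential-image clause, PROVED in the tree
(`DeligneMilne1982_Thm_6_20_essImage_holds`, `CorCM/Geometry/RiemannEssentialImage`) — `H ≅ H¹_B(E)` in Hod_ℚ for a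
complex abelian variety `E`, of dimension `1` (`dim_ℚ H¹ = 2 dim E`).  Then (§1, for any `A` with `H¹_B(A) ≅ H₂`
and `End(H₂) = ℚ`):
* every `ℚ`-linear endomorphism of `H¹(A(ℂ); ℚ)` preserving the Hodge filtration is a rational scalar
  (`ratEnd_eq_smul_of_map_F_le`; transport along the isomorphism, whose inverse is a morphism by strictness,
  `Hom.symmOfBijective`; model independence of `H¹_B`, `bettiOneHodgeStructure_eq_cast_hodge`);
* hence `EllipticCurve.HodgeEndTrivial A` (`hodgeEndTrivial_of_hom`: a rational `ℂ`-linear `T` descends to `ℚ`,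
  `exists_ratLinearMap_of_isRationalClass_map`, and preserving `(1,0)`-classes is preserving `F¹`,
  `BettiUniverse.mem_hodge_F_one_iff`);
* hence `End⁰(A) = ℚ` (`exists_eq_algebraMap`, `finrank_endAlgebra_eq_one`: `F^*` is a Hodge endomorphism,
  `BettiUniverse.pull_hodge`, and the rational representation is faithful, `bettiRep_injective`);
* hence `A` is not of CM type (`not_isOfCMType`: a commutative reduced subalgebra of degree `2 dim A ≥ 2` does not
  fit in `ℚ`).

This file lives Summits-side only because the essential-image half of Riemann's theorem is proved Summits-side;
every other input is a Literature theorem.  HONEST SCOPE: an existence/non-vacuity statement about ONE curve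
(`E = ℂ/(ℤ + (√2 + i)ℤ)` up to isogeny, through Hodge theory); nothing here bears on HC_CM or on the summit.

## References

* [MoonenZarhin1999LowDim] B. Moonen, Yu. Zarhin, *Hodge classes on abelian varieties of low dimension*,
  Math. Ann. 315 (1999) 711–733, §2 (`g = 1`: Type I(1) `End⁰ = ℚ`, Type IV(1,1) CM).
* [DeligneMilne1982Tannakian] P. Deligne, J. S. Milne, *Tannakian Categories*, LNM 900 (1982), §6 Thm. 6.20
  (Riemann), p. 212.
* [LangeBirkenhake1992] H. Lange, Ch. Birkenhake, *Complex Abelian Varieties* (1992), §1.1 (the rational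
  representation is faithful), §1.2 Prop. 1.2.3, Thm. 4.2.1.
* [Milne1999] J. S. Milne, *Lefschetz motives and the Tate conjecture*, Compositio Math. 117 (1999), §2 p. 54
  (CM type).
* [VoisinHodgeI2002] C. Voisin, *Hodge Theory and Complex Algebraic Geometry I* (2002), §7.1.1 Def. 7.4, §7.3.

Provenance: Literature home (family `hodge`) of the Summits-side `CorCM/Assembly/NonCMEllipticCurveExists` (cell `pub-hodgecm2`, COR-CM assembly; all its imports are `Literature/` but the chain itself), which `Literature/` may not import; theorems only, no named fact, no definition. Nothing here bears on `HC_CM`; no case of the Hodge conjecture is proved. Lane `lit-hodgefound` (Layer A1/A3: weight-one Hodge structures, CM and non-CM elliptic curves), seat p20.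
-/

noncomputable section

open scoped TensorProduct
open _root_.CategoryTheory Module
open Literature.AlgebraicGeometry.Motives Literature.AlgebraicGeometry.HodgeTheory
open Literature.AlgebraicGeometry.ComplexMultiplication
open Literature.AlgebraicGeometry.Motives.HodgeStructure

namespace Literature.AlgebraicGeometry.HodgeTheory.NonCMCurve

/-! ## §1 Abelian varieties whose `H¹_B` is isomorphic to a Hodge structure with scalar endomorphisms only -/

section Transport

universe u v

variable {V : Type u} [AddCommGroup V] [Module ℚ V] {W : Type v} [AddCommGroup W] [Module ℚ W] {n : ℤ}

/-- **«Only scalar endomorphisms» is invariant under isomorphism in Hod_ℚ**: if `f : H₁ → H₂` is a morphism of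
Hodge structures with bijective underlying map and every endomorphism of `H₂` is a rational scalar, then so is
every endomorphism `T` of `H₁` (`f ∘ T ∘ f⁻¹` is an endomorphism of `H₂`; `f⁻¹` is a morphism by strictness,
`Hom.symmOfBijective`). [cite: DeligneHodgeII1971, Thm. 2.3.5(iii)] -/
theorem hom_eq_smul_of_bijective {H₁ : HodgeStructure V n} {H₂ : HodgeStructure W n} (f : Hom H₁ H₂)
    (hf : Function.Bijective f.toLinearMap)
    (h₂ : ∀ S : Hom H₂ H₂, ∃ r : ℚ, S.toLinearMap = r • LinearMap.id) (T : Hom H₁ H₁) :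
    ∃ r : ℚ, T.toLinearMap = r • LinearMap.id := by
  obtain ⟨r, hr⟩ := h₂ (Hom.comp f (Hom.comp T (f.symmOfBijective hf)))
  refine ⟨r, LinearMap.ext fun v => hf.1 ?_⟩
  have h := LinearMap.congr_fun hr (f.toLinearMap v)
  change f.toLinearMap (T.toLinearMap ((f.symmOfBijective hf).toLinearMap (f.toLinearMap v))) = _ at h
  rw [Hom.symmOfBijective_apply_apply, LinearMap.smul_apply, LinearMap.id_apply] at h
  rw [h, LinearMap.smul_apply, LinearMap.id_apply, map_smul]

end Transport

section AbelianVariety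

variable {A : AbelianVariety ℂ} {B : HodgeModel A.dim A.X} {hB : B.IsHodgeSymmetric}
  {W : Type} [AddCommGroup W] [Module ℚ W] {H₂ : HodgeStructure W 1}
  (f : Hom (bettiOneHodgeStructure A B hB) H₂) (hf : Function.Bijective f.toLinearMap)
  (h₂ : ∀ S : Hom H₂ H₂, ∃ r : ℚ, S.toLinearMap = r • LinearMap.id)

/-- **A `ℚ`-linear map on `H¹(A(ℂ); ℚ)` whose complexification carries classes of type `(1,0)` to classes of
type `(1,0)` preserves the whole Hodge filtration** of the weight-one structure `BettiUniverse.hodge A 1`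
(`F⁰ = ⊤`, `F¹ = Θ'⁻¹(H^{1,0})` by `BettiUniverse.mem_hodge_F_one_iff`, `F² = ⊥`).
[cite: VoisinHodgeI2002, §7.1.1 Def. 7.4] [cite: LangeBirkenhake1992, Thm. 4.2.1] -/
theorem map_F_le_of_isOfHodgeType_oneZero (ψ : bettiCohomology A.X 1 →ₗ[ℚ] bettiCohomology A.X 1)
    (h10 : ∀ x : ℂ ⊗[ℚ] bettiCohomology A.X 1,
      IsOfHodgeType A.dim A.X 1 1 0 (ofRatClassBaseChange (ComplexPoints A.X) 1 x) →
        IsOfHodgeType A.dim A.X 1 1 0 (ofRatClassBaseChange (ComplexPoints A.X) 1 (ψ.baseChange ℂ x)))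
    (p : ℤ) :
    ((BettiUniverse.hodge exists_isReal_hodgeModel_holds (AbelianVariety.isSmoothProjective_holds (A := A)) 1).F p).map
        (ψ.baseChange ℂ) ≤
      (BettiUniverse.hodge exists_isReal_hodgeModel_holds (AbelianVariety.isSmoothProjective_holds (A := A)) 1).F p := by
  by_cases hp : p ≤ 0
  · rw [BettiUniverse.hodge_F, HodgeModel.ratF_of_nonpos (hr := hp)]
    exact le_top
  by_cases hp1 : p = 1
  · subst hp1
    intro y hy
    obtain ⟨x, hx, rfl⟩ := Submodule.mem_map.1 hy
    exact (BettiUniverse.mem_hodge_F_one_iff exists_isReal_hodgeModel_holds hodgePQ_independent_of_hodgeModel_holds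
      AbelianVariety.isSmoothProjective_holds _).2 (h10 x
        ((BettiUniverse.mem_hodge_F_one_iff exists_isReal_hodgeModel_holds hodgePQ_independent_of_hodgeModel_holds
          AbelianVariety.isSmoothProjective_holds _).1 hx))
  · rw [BettiUniverse.hodge_F, HodgeModel.ratF_eq_bot (hr := by push_cast; omega), Submodule.map_bot]

include f hf h₂

/-- **If `H¹_B(A) ≅ H₂` in Hod_ℚ and `End(H₂) = ℚ`, every `ℚ`-linear endomorphism of `H¹(A(ℂ); ℚ)` preserving
the Hodge filtration is a rational scalar** (the structure `BettiUniverse.hodge A 1` is `H¹_B(A)` read in any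
Hodge-symmetric model, `bettiOneHodgeStructure_eq_cast_hodge`).
[cite: DeligneMilne1982Tannakian, art. II §6 Thm. 6.20 (Riemann), LNM 900 p. 212] [cite: VoisinHodgeI2002, §7.1.1 Def. 7.4] -/
theorem ratEnd_eq_smul_of_map_F_le (ψ : bettiCohomology A.X 1 →ₗ[ℚ] bettiCohomology A.X 1)
    (hψ : ∀ p : ℤ,
      ((BettiUniverse.hodge exists_isReal_hodgeModel_holds (AbelianVariety.isSmoothProjective_holds (A := A)) 1).F p).map
          (ψ.baseChange ℂ) ≤
        (BettiUniverse.hodge exists_isReal_hodgeModel_holds (AbelianVariety.isSmoothProjective_holds (A := A)) 1).F p) :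
    ∃ r : ℚ, ψ = r • LinearMap.id := by
  have e := bettiOneHodgeStructure_eq_cast_hodge exists_isReal_hodgeModel_holds
    hodgePQ_independent_of_hodgeModel_holds A B hB AbelianVariety.isSmoothProjective_holds
  let T : Hom (bettiOneHodgeStructure A B hB) (bettiOneHodgeStructure A B hB) :=
    ⟨ψ, fun p => by rw [e, cast_F]; exact hψ p⟩
  exact hom_eq_smul_of_bijective f hf h₂ T

/-- **`H¹_B(A) ≅ H₂` with `End(H₂) = ℚ` ⟹ `A` has no complex multiplication in the Hodge-theoretic sense**
(`EllipticCurve.HodgeEndTrivial A`: every `ℂ`-linear endomorphism of `H¹(A(ℂ); ℂ)` preserving rational classes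
and the Hodge types `(1,0)`, `(0,1)` is a scalar).  Such a `T` descends to `ℚ`-coefficients
(`exists_ratLinearMap_of_isRationalClass_map`), preserves the Hodge filtration
(`map_F_le_of_isOfHodgeType_oneZero`), hence is a rational scalar (`ratEnd_eq_smul_of_map_F_le`).
[cite: MoonenZarhin1999LowDim, §2 (g = 1), Type I(1)] [cite: LangeBirkenhake1992, §1.2 and Thm. 4.2.1] -/
theorem hodgeEndTrivial_of_hom : EllipticCurve.HodgeEndTrivial A := by
  intro T hrat h10 _h01
  have hX := AbelianVariety.isSmoothProjective_holds (A := A)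
  obtain ⟨ψ, hψ⟩ := exists_ratLinearMap_of_isRationalClass_map T hrat
  have hF := map_F_le_of_isOfHodgeType_oneZero ψ (fun x hx => by rw [hψ]; exact h10 _ hx)
  obtain ⟨r, hr⟩ := ratEnd_eq_smul_of_map_F_le f hf h₂ ψ hF
  refine ⟨(r : ℂ), LinearMap.ext fun c => ?_⟩
  obtain ⟨t, rfl⟩ := (ofRatClassBaseChangeEquiv hX 1).surjective c
  rw [ofRatClassBaseChangeEquiv_apply, ← hψ, hr, LinearMap.baseChange_smul, LinearMap.baseChange_id,
    LinearMap.smul_apply, LinearMap.id_apply, LinearMap.smul_apply, LinearMap.id_apply,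
    ← algebraMap_smul ℂ r t, map_smul]
  rfl

/-- **`H¹_B(A) ≅ H₂` with `End(H₂) = ℚ` ⟹ `End⁰(A) = ℚ`**: every element of `End⁰(A) = ℚ ⊗ End A` is
`M⁻¹ · (1 ⊗ F)`; `F^*` preserves the Hodge filtration of `H¹(A(ℂ); ℚ)` (`BettiUniverse.pull_hodge`), hence is
a rational scalar `r`, and the rational representation is faithful (`bettiRep_injective`), so the element is
`M⁻¹ r ∈ ℚ · 1`. [cite: LangeBirkenhake1992, §1.1 (ρ_r is injective) and §1.2 Prop. 1.2.3]
[cite: MoonenZarhin1999LowDim, §2 (g = 1), Type I(1)] -/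
theorem exists_eq_algebraMap (x : A.endAlgebra) : ∃ c : ℚ, x = algebraMap ℚ A.endAlgebra c := by
  obtain ⟨M, F, hM, rfl⟩ := AbelianVariety.endAlgebra.exists_eq_algebraMap_mul_of x
  have hF := BettiUniverse.pull_hodge exists_isReal_hodgeModel_holds hodgePQ_independent_of_hodgeModel_holds
    (AbelianVariety.isSmoothProjective_holds (A := A)) (AbelianVariety.isSmoothProjective_holds (A := A))
    F.hom.hom.hom 1
  obtain ⟨r, hr⟩ := ratEnd_eq_smul_of_map_F_le f hf h₂ (BettiUniverse.pull F.hom.hom.hom 1) hF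
  refine ⟨(M : ℚ)⁻¹ * r, bettiRep_injective ?_⟩
  have hop : MulOpposite.op (bettiCohomology.map F.hom.hom.hom 1).hom =
      algebraMap ℚ (Module.End ℚ (bettiCohomology A.X 1))ᵐᵒᵖ r := by
    change MulOpposite.op (BettiUniverse.pull F.hom.hom.hom 1) = _
    rw [hr, MulOpposite.op_smul, ← Module.End.one_eq_id, MulOpposite.op_one, Algebra.algebraMap_eq_smul_one]
  rw [map_mul, AlgHom.commutes, bettiRep_of, hop, ← map_mul, AlgHom.commutes]

/-- **`H¹_B(A) ≅ H₂` with `End(H₂) = ℚ` ⟹ `dim_ℚ End⁰(A) = 1`** (for `dim A > 0`, so that `End⁰(A) ≠ 0`: the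
algebra map `ℚ → End⁰(A)` is a bijection). [cite: MoonenZarhin1999LowDim, §2 (g = 1), Type I(1)] -/
theorem finrank_endAlgebra_eq_one (hA : 0 < A.dim) : Module.finrank ℚ A.endAlgebra = 1 := by
  haveI : Nontrivial A.endAlgebra := nontrivial_endAlgebra_of_dim_pos hA
  have hbij : Function.Bijective (Algebra.linearMap ℚ A.endAlgebra) :=
    ⟨(algebraMap ℚ A.endAlgebra).injective, fun x => by
      obtain ⟨c, rfl⟩ := exists_eq_algebraMap f hf h₂ x
      exact ⟨c, rfl⟩⟩
  rw [← (LinearEquiv.ofBijective _ hbij).finrank_eq, Module.finrank_self]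

/-- **`H¹_B(A) ≅ H₂` with `End(H₂) = ℚ` ⟹ `A` is NOT of CM type** (Milne 1999 §2: a commutative reduced
subalgebra of `End⁰(A)` of degree `2 dim A ≥ 2` cannot sit inside `End⁰(A) = ℚ`). [cite: Milne1999, §2 p. 54] -/
theorem not_isOfCMType (hA : 0 < A.dim) : ¬ Literature.AlgebraicGeometry.Milne1999.IsOfCMType A := by
  rintro ⟨S, -, -, hS⟩
  haveI : Module.Finite ℚ A.endAlgebra := AbelianVariety.finiteDimensional_endAlgebra_holds A
  have hle := Submodule.finrank_le (Subalgebra.toSubmodule S)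
  rw [Subalgebra.finrank_toSubmodule, hS, finrank_endAlgebra_eq_one f hf h₂ hA] at hle
  omega

omit h₂ in
/-- `2 dim A = dim_ℚ W` when `H¹_B(A) ≅ H₂` (`dim_ℚ H¹(A(ℂ); ℚ) = 2 dim A`). [cite: LangeBirkenhake1992, §1.1 Lemma 1.1.17] -/
theorem two_mul_dim_eq_finrank [Module.Finite ℚ W] : 2 * A.dim = Module.finrank ℚ W := by
  rw [← finrank_bettiCohomology_one A]
  exact (LinearEquiv.ofBijective f.toLinearMap hf).finrank_eq

end AbelianVariety

/-! ## §2 The period `τ₀ = √2 + i`: a weight-one Hodge structure on `ℚ²` with only scalar endomorphisms -/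

/-- **`τ₀ = √2 + i` satisfies no rational quadratic equation**: `a τ₀² + b τ₀ + c = 0` with `a, b, c ∈ ℚ` reads
`(a + c + b√2) + (2√2 a + b) i = 0`, and `√2 ∉ ℚ` (Mathlib's `irrational_sqrt_two`). [cite: MoonenZarhin1999LowDim, §2 (g = 1)] -/
theorem sqrtTwoAddI_noQuadratic (a b c : ℚ)
    (h : (a : ℂ) * (Complex.mk (Real.sqrt 2) 1) ^ 2 + b * (Complex.mk (Real.sqrt 2) 1) + c = 0) :
    a = 0 ∧ b = 0 ∧ c = 0 := by
  have hre := congrArg Complex.re h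
  have him := congrArg Complex.im h
  simp only [sq, Complex.add_re, Complex.mul_re, Complex.ratCast_re, Complex.ratCast_im,
    Complex.add_im, Complex.mul_im, Complex.zero_re, Complex.zero_im, zero_mul, sub_zero, mul_one, one_mul,
    add_zero] at hre him
  -- him : a * (√2 + √2) + b = 0 ;  hre : a * (√2√2 - 1) + b √2 + c = 0
  have ha : a = 0 := by
    by_contra ha
    have hQ : Real.sqrt 2 = ((-b / (2 * a) : ℚ) : ℝ) := by
      have ha' : (a : ℝ) ≠ 0 := by exact_mod_cast ha
      push_cast
      field_simp
      linarith
    exact (irrational_sqrt_two.ne_rat _) hQ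
  have hb : (b : ℝ) = 0 := by
    rw [ha, Rat.cast_zero, zero_mul, zero_add] at him
    exact him
  have hc : (c : ℝ) = 0 := by
    rw [ha, Rat.cast_zero, zero_mul, zero_add, hb, zero_mul, zero_add] at hre
    exact hre
  exact ⟨ha, by exact_mod_cast hb, by exact_mod_cast hc⟩

/-- **A polarisable, effective weight-one `ℚ`-Hodge structure on `ℚ²` all of whose endomorphisms are rational
scalars exists**: `V¹_{τ₀}`, `τ₀ = √2 + i` (`Geometry/WeightOneHodgeStructureOfPeriod`; the `H¹` of the torus
`ℂ/(ℤ + (√2 + i)ℤ)`, Moonen–Zarhin 1999 §2 Type I(1) since `[ℚ(τ₀) : ℚ] = 4 ≠ 2`).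
[cite: MoonenZarhin1999LowDim, §2 (g = 1), Type I(1)] [cite: LangeBirkenhake1992, §1.2 and Thm. 4.2.1] -/
theorem exists_weightOne_rankTwo_hom_eq_smul :
    ∃ H : HodgeStructure (Fin 2 → ℚ) 1, H.IsPolarizable ∧ H.IsEffective ∧
      ∀ S : Hom H H, ∃ r : ℚ, S.toLinearMap = r • LinearMap.id :=
  PeriodHodgeStructure.exists_weightOne_rankTwo_hom_eq_smul_of (τ := Complex.mk (Real.sqrt 2) 1) one_pos
    sqrtTwoAddI_noQuadratic

/-! ## §3 Existence of a non-CM elliptic curve -/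

/-- **A complex elliptic curve WITHOUT complex multiplication exists.**  There is a complex abelian variety `E`
of dimension `1` such that (i) `EllipticCurve.HodgeEndTrivial E` — every `ℂ`-linear endomorphism of
`H¹(E(ℂ); ℂ)` preserving rational classes and the Hodge types is a scalar (Moonen–Zarhin 1999 §2 Type I(1),
the tree's Hodge-theoretic «no CM» predicate), (ii) `End⁰(E) = ℚ` (`dim_ℚ End⁰(E) = 1`), and (iii) `E` is not
of CM type in Milne's sense (`¬ Milne1999.IsOfCMType E`).  Construction: by Riemann's theorem (essential image,
`DeligneMilne1982_Thm_6_20_essImage_holds`) the polarisable effective weight-one Hodge structure on `ℚ²` with only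
scalar endomorphisms `V¹_{τ₀}`, `τ₀ = √2 + i` (`exists_weightOne_rankTwo_hom_eq_smul`) is `H¹_B(E)` of
an abelian variety `E`, necessarily of dimension `1`.  NON-VACUITY of the hypothesis class of the tree's
theorems on powers and products of non-CM elliptic curves and of every `¬ IsOfCMType` hypothesis.
[cite: MoonenZarhin1999LowDim, §2 (g = 1), Type I(1)] [cite: DeligneMilne1982Tannakian, art. II §6 Thm. 6.20 (Riemann), LNM 900 p. 212]
[cite: LangeBirkenhake1992, §1.2 and Thm. 4.2.1] -/
theorem exists_ellipticCurve_not_isOfCMType :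
    ∃ E : AbelianVariety ℂ, E.dim = 1 ∧ EllipticCurve.HodgeEndTrivial E ∧
      Module.finrank ℚ E.endAlgebra = 1 ∧ ¬ Literature.AlgebraicGeometry.Milne1999.IsOfCMType E := by
  obtain ⟨H, hpol, heff, hEnd⟩ := exists_weightOne_rankTwo_hom_eq_smul
  obtain ⟨E, B, hB, f, hf⟩ := DeligneMilne1982_Thm_6_20_essImage_holds H hpol heff
  have h2 := two_mul_dim_eq_finrank f hf
  rw [Module.finrank_fin_fun] at h2
  have hdim : E.dim = 1 := by omega
  exact ⟨E, hdim, hodgeEndTrivial_of_hom f hf hEnd, finrank_endAlgebra_eq_one f hf hEnd (by omega),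
    not_isOfCMType f hf hEnd (by omega)⟩

/-- **Non-vacuity of `EllipticCurve.HodgeEndTrivial`**: an elliptic curve with `HodgeEndTrivial` exists.
[cite: MoonenZarhin1999LowDim, §2 (g = 1), Type I(1)] -/
theorem exists_ellipticCurve_hodgeEndTrivial :
    ∃ E : AbelianVariety ℂ, E.dim = 1 ∧ EllipticCurve.HodgeEndTrivial E := by
  obtain ⟨E, h1, h2, -, -⟩ := exists_ellipticCurve_not_isOfCMType
  exact ⟨E, h1, h2⟩

/-- **Non-vacuity of «not of CM type»**: a complex abelian variety (of dimension `1`) which is not of CM type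
exists. [cite: Milne1999, §2 p. 54] [cite: MoonenZarhin1999LowDim, §2 (g = 1), Type I(1)] -/
theorem exists_abelianVariety_not_isOfCMType :
    ∃ E : AbelianVariety ℂ, E.dim = 1 ∧ ¬ Literature.AlgebraicGeometry.Milne1999.IsOfCMType E := by
  obtain ⟨E, h1, -, -, h4⟩ := exists_ellipticCurve_not_isOfCMType
  exact ⟨E, h1, h4⟩

/-- **Non-vacuity of «`End⁰ = ℚ`»**: a complex abelian variety of positive dimension with `dim_ℚ End⁰ = 1`
exists. [cite: MoonenZarhin1999LowDim, §2 (g = 1), Type I(1)] -/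
theorem exists_abelianVariety_finrank_endAlgebra_eq_one :
    ∃ E : AbelianVariety ℂ, E.dim = 1 ∧ Module.finrank ℚ E.endAlgebra = 1 := by
  obtain ⟨E, h1, -, h3, -⟩ := exists_ellipticCurve_not_isOfCMType
  exact ⟨E, h1, h3⟩

end Literature.AlgebraicGeometry.HodgeTheory.NonCMCurve

end
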